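import Literature.AlgebraicGeometry.AbelianVarieties.HomogeneousLineBundleMulPullback
import Literature.AlgebraicGeometry.Motives.AbelianVarietyTranslationInvariantAmple
import Literature.AlgebraicGeometry.Motives.AlgPointsMapSurjectiveAlgClosed
import HarnessLib

/-!
# `φ`-classes along homomorphisms, `[n]^*` on translation-invariant classes, and «divisible kills torsion»

Layer `Literature/AlgebraicGeometry/AbelianVarieties`, namespace `Literature.AlgebraicGeometry.AbelianVarieties`.
Cell `hodgecm-mathlib`, HECKE-LINK (X-amp-1) «`Λ(M^Δ) = 2λ_B`», generic FIELD part (X1-A).  THEOREMS ONLY.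

For an abelian variety `A` over a field `K` and classes `c ∈ Ȟ¹(A, 𝒪^×)` (`CechPic`), with the tree's
`φ_c(x) = t_x^*c·c⁻¹` (★ `phiPic`, [Lange2023AbelianVarietiesC] §1.4.2 / [MumfordAV1970] §8 `Λ(L)`):

* §1 `phiPic_pullback_hom` — **`φ_{j^*c}(P) = j^*φ_c(j(P))`** for a homomorphism `j : B → A` (translations commute with
  homomorphisms, ★ `translation_comp_hom`); `pullback_translation_phiPic` — **`t_y^* φ_c(x) = φ_c(x)`** (theorem of the square, ★
  `pullback_translation_mul_mul_self'`): the values of `φ_c` are translation invariant;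
* §2 `cechPic_pullback_pow_id_of_forall_translation` — **`[n]^*c = cⁿ` for a translation-invariant class `c`** (`K` algebraically
  closed; class form of ★ `cechPic_pullback_pow_id_detClass`, [MumfordAV1970] §8 (iv));
* §3 `MonoidHom.apply_eq_one_of_pow_surjective_of_pow_eq_one` — a homomorphism from a group in which `x ↦ xⁿ` is onto to a group,
  all of whose values are killed by `n`, is trivial; `phiPic`-free corollary `eq_one_of_forall_pow_eq_one_of_isAlgClosed` for
  `A(Ω)`, `Ω` algebraically closed with `n ≠ 0` in `Ω` (★ `AbelianVariety.pow_surjective_of_isAlgClosed`).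

HC_CM is proved only modulo the 7 printed citations until rung 0 closes; nothing here is about HC.

## References
* [MumfordAV1970] D. Mumford, *Abelian Varieties* (1970), §6 Cor. 4 (p. 59) (theorem of the square), §8 (pp. 74–75).
* [Lange2023AbelianVarietiesComplex] H. Lange, *Abelian Varieties over the Complex Numbers* (2023), §1.4.2 (`φ_L`).
-/

noncomputable section

open CategoryTheory CategoryTheory.Limits AlgebraicGeometry MonoidalCategory CartesianMonoidalCategory
open scoped MonObj

universe u

-- `Scheme.Modules` / `SheafOfModules` are not reducible (as in Mathlib's `AlgebraicGeometry/Modules/Sheaf.lean`).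
set_option backward.isDefEq.respectTransparency false

namespace Literature.AlgebraicGeometry.AbelianVarieties

open Literature.AlgebraicGeometry.Motives Literature.AlgebraicGeometry.Modules

variable {K : Type u} [Field K] (A : AbelianVariety K)

/-! ## §1 `φ` along homomorphisms; translation invariance of `φ_c(x)` -/

/-- **`φ_{j^*c}(P) = j^*(φ_c(j(P)))`** for a homomorphism `j : B → A` of abelian varieties, a class `c` on `A` and `P ∈ B(K)`:
`t_P ≫ j = j ≫ t_{j(P)}` (★ `translation_comp_hom`). [cite: MumfordAV1970, §8 (pp. 74–75)] -/
theorem phiPic_pullback_hom {B : AbelianVariety K} (j : B ⟶ A) (c : CechPic A.X.left) (P : B.Points K) :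
    phiPic B (CechPic.pullback j.hom.hom.hom.left c) P =
      CechPic.pullback j.hom.hom.hom.left (phiPic A c (P ≫ j.hom.hom.hom)) := by
  unfold phiPic
  rw [map_div, ← CechPic.pullback_comp, ← Over.comp_left, AbelianVariety.translation_comp_hom, Over.comp_left,
    CechPic.pullback_comp]

/-- **`t_y^* φ_c(x) = φ_c(x)`**: the values of `φ_c` are translation invariant — the theorem of the square
`t_{xy}^*c · c = t_x^*c · t_y^*c` (★ `pullback_translation_mul_mul_self'`) rearranged with `t_y ≫ t_x = t_{xy}`.
[cite: MumfordAV1970, §6 Cor. 4 (p. 59) and §8] -/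
theorem pullback_translation_phiPic (c : CechPic A.X.left) (x y : A.Points K) :
    CechPic.pullback (A.translation y).left (phiPic A c x) = phiPic A c x := by
  unfold phiPic
  have hsq := pullback_translation_mul_mul_self' A c x y
  rw [map_div, ← CechPic.pullback_comp, ← Over.comp_left, AbelianVariety.translation_comp', div_eq_div_iff_mul_eq_mul,
    mul_comm y x, hsq, mul_comm]

/-! ## §2 `[n]^*c = cⁿ` for translation-invariant classes -/

/-- **`[n]^*c = cⁿ` for a translation-invariant class `c ∈ Ȟ¹(A, 𝒪^×)`** over an algebraically closed field (`[n] = 𝟙_Aⁿ` in the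
group of `A`-valued points): `c = [𝒪(D)]` (★ `CechPic.exists_cechClass_eq`), `𝒪(D)` is homogeneous (★
`isHomogeneous_lineBundle_iff_forall_linEquiv`), and ★ `cechPic_pullback_pow_id_detClass`. [cite: MumfordAV1970, §8 ((iv), p. 75)] -/
theorem cechPic_pullback_pow_id_of_forall_translation [IsAlgClosed K] (c : CechPic A.X.left)
    (hc : ∀ y : A.Points K, CechPic.pullback (A.translation y).left c = c) (n : ℕ) :
    CechPic.pullback (((𝟙 A.X : A.X ⟶ A.X) ^ n : A.X ⟶ A.X)).left c = c ^ n := by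
  obtain ⟨D, rfl⟩ := CechPic.exists_cechClass_eq c
  have hhom : IsHomogeneous A (lineBundle D.toUnitCocycle) := by
    rw [isHomogeneous_lineBundle_iff_forall_linEquiv]
    intro P
    rw [← CartierDivisor.cechClass_eq_iff_linEquiv, CartierDivisor.cechClass_pullback]
    exact hc P
  have h := cechPic_pullback_pow_id_detClass A D.toUnitCocycle.hasRank_lineBundle D.toUnitCocycle.isFiniteLocallyFree_lineBundle
    hhom n
  rwa [detClass_lineBundle_toUnitCocycle] at h

/-- `φ_c(x)` is killed by `[n]^*` exactly as an `n`-th power: `[n]^*(φ_c(x)) = φ_c(x)ⁿ` (§1 + §2). [cite: MumfordAV1970, §8 ((iv), p. 75)] -/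
theorem cechPic_pullback_pow_id_phiPic [IsAlgClosed K] (c : CechPic A.X.left) (x : A.Points K) (n : ℕ) :
    CechPic.pullback (((𝟙 A.X : A.X ⟶ A.X) ^ n : A.X ⟶ A.X)).left (phiPic A c x) = phiPic A c x ^ n :=
  cechPic_pullback_pow_id_of_forall_translation A _ (fun y => pullback_translation_phiPic A c x y) n

/-! ## §3 «Divisible kills torsion» -/

/-- A homomorphism from a group in which `n`-th powers are onto to any group, all of whose values are killed by `n`, is trivial:
`f(g) = f(hⁿ) = f(h)ⁿ = 1`. [cite: MumfordAV1970, §8 (pp. 74–75)] -/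
theorem _root_.MonoidHom.apply_eq_one_of_pow_surjective_of_pow_eq_one {G H : Type*} [Group G] [CommGroup H] (f : G →* H)
    {n : ℕ} (hG : Function.Surjective fun g : G => g ^ n) (hf : ∀ g, f g ^ n = 1) (g : G) : f g = 1 := by
  obtain ⟨h, rfl⟩ := hG g
  rw [map_pow]
  exact hf h

/-- **On `A(Ω)`, `Ω` algebraically closed with `n ≠ 0` in `Ω`, a homomorphism into a commutative group all of whose values are
`n`-torsion is trivial** (`A(Ω)` is `n`-divisible, ★ `AbelianVariety.pow_surjective_of_isAlgClosed`). [cite: MumfordAV1970, §8 (pp. 74–75)] -/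
theorem eq_one_of_forall_pow_eq_one_of_isAlgClosed {Ω : Type u} [Field Ω] [IsAlgClosed Ω] (A : AbelianVariety Ω)
    {H : Type*} [CommGroup H] (f : A.Points Ω →* H) {n : ℕ} (hn : (n : Ω) ≠ 0) (hf : ∀ g, f g ^ n = 1) (g : A.Points Ω) :
    f g = 1 :=
  f.apply_eq_one_of_pow_surjective_of_pow_eq_one (AbelianVariety.pow_surjective_of_isAlgClosed A n hn) hf g

end Literature.AlgebraicGeometry.AbelianVarieties

end
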